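import Mathlib
import HarnessLib
import Literature.MathematicalPhysics.StatisticalMechanics.LennardJonesClusters
import Summits.AtomisticToContinuum.Crystallization.Theorems.ContactSaturationLadderHaloCount
import Summits.AtomisticToContinuum.Crystallization.Theorems.ContactSaturationLadderDensityFloor
import Summits.AtomisticToContinuum.Crystallization.Theorems.ChessboardParticlePlanesLjLaminarWindowsMinDistance

/-!
# ContactSaturationLadderChunkDoor — the route-independent ORDER STRUCTURE of the residual pair of crux `LooseTextureRung`, part 1 of 3:
chunk doors, radius rungs, and the marker-generic fraction ladder (helper, supports item 30303)

Helper for route `ContactSaturationLadder` (sub-problem `Crystallization`), crux `LooseTextureRung`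
(stmt-AtomisticToContinuum-30303, DECLARED RESIDUAL-CORE), registered line «DialFreeSieveV6» v6.3 (lens-1 lineage `decomp-a2c-lens-1`,
cell `decomp-a2c`; the registered skeleton and its stubs are UNTOUCHED — nothing here is a registered item).  LANDING PICKED by the cell
critic (`decomp-a2c-crit-1`, CRITIC-LEDGER row 283 (ε), bus STATUS l.1402): «Theorems landing of the GS-free, route-independent §30/§31
order lemmas (recentring kernel, door ⟹ rung, NLC ⟺ ∃ r NoLooseChunkAt r, NLC ⟺ NEAR(φ) ∧ Φ_∞ < φ, DIP ⟸ FCE) as a helper».  Source: the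
lineage node g23 (`LooseTextureRung_node_g23.lean`, sha256 d04ae943…, §24–§31, kernel-checked there against the tree item).  Every statement
below is PROVED (0 sorry, standard axioms).
PART 1 (this file): the fraction-free core and the ladder's rungs and doors; PART 2 `ContactSaturationLadderChunkProfile`: the loss-free
transfer K5♯ and the profile `Φ_F`, `Φ_∞`; PART 3 `ContactSaturationLadderChunkNear`: the NEAR side modulo the window ceiling (one-rung kernel,
merger, exact cut, quantisation).

## Design: marker-generic and Theses-free

The node states its far-fraction ladder for the lineage's sieve marker `farSet ℓ (3/50) s y` (lens-5's
`LoopTunnelDialSieveCurrency.farSet`), whose module imports the route's own `Theses` file; a helper of the same route cannot import it.  ALL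
the order lemmas are, however, INDEPENDENT of what «far» means, so they are stated for an ARBITRARY MARKER
`F : SiteMarker := (N : ℕ) → (Fin N → ℝ³) → Finset (Fin N)`; the node recovers its statements by instantiating
`F := fun _ y => farSet ℓ (3/50) s y` (`Iff.rfl`).  The density input is the TREE filling floor
`ContactSaturationLadderDensityFloor.card_window_ge_of_not_voidAdj` (`(R−1)³ ≤ #B(c,R)` on 2-void-free doubled windows), used in the cubed
form `ρ³ ≤ 8·#B(c,ρ)` (`ρ ≥ 2`); the separation is the TREE's `lennardJones_groundState_dist_ge_seven_tenths`.  Vocabulary `looseSet`,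
`voidAdjSet` from `ContactSaturationLadderHaloCount` (verbatim the text inlined in the tree item).

## Contents

§1 `gsMinDist` — the infimum of pair distances over all Lennard-Jones ground states (`> 0`, `≥ 7/10`, below every ground-state pair distance).
§2 Filling in cubed form: `ρ³ ≤ 8·#B(c,ρ)` on a 2-void-free doubled window whose inner window holds a particle (`ρ ≥ 2`).
§3 THE FRACTION-FREE CORE: the radius rung `NoLooseChunkAt r`, «no loose chunks» `NoLooseChunks` (NLC), the RECENTRING KERNEL
   (`NoLooseChunkAt r → NoLooseChunkAt ρ`, `ρ ≥ 2r`), NLC ⟺ `∃ r ≥ 0, NoLooseChunkAt r`, the GS-free canonical CHUNK DOOR `ChunkDoor r`, K6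
   «door ⟹ rung» (a ground state admits no strict improvement), the door's own recentring, and its explicit-separation form `ChunkDoorSep`.
§4 THE MARKER-GENERIC FRACTION LADDER: the rung `NoMarkedChunkAt F ρ φ`, exclusion `MarkedChunkExclusion F` (and its one-radius form), the
   implant door `MarkedImplantDoor F ρ φ`, K3 «door ⟹ rung», monotonicity in `φ` and in the marker, NLC ⟹ exclusion, and the fraction-0 rung
   = the radius rung with the marker erased (with its own loss-free recentring: a fraction-0 rung at ONE radius is already exclusion).
-/

noncomputable section

open scoped BigOperators Topology Classical
open Filter Metric
open Literature.MathematicalPhysics.StatisticalMechanics (lennardJones IsGroundState interactionEnergy groundStateEnergy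
  LennardJonesMinimalDistance_holds LennardJonesGroundStatesExist_holds groundStateEnergy_lennardJones_le)
open Summit.AtomisticToContinuum.Crystallization.Theorems
open Summit.AtomisticToContinuum.Crystallization.Theorems.ContactSaturationLadderHaloCount (looseSet voidAdjSet)
open Summit.AtomisticToContinuum.Crystallization.Theorems.ContactSaturationLadderDensityFloor (card_window_ge_of_not_voidAdj)
open Summit.AtomisticToContinuum.Crystallization.Theorems.LjLaminarWindowsSketch (lennardJones_groundState_dist_ge_seven_tenths)

namespace Summit.AtomisticToContinuum.Crystallization.Theorems.ContactSaturationLadderChunkDoor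

/-! ## §1 The ground-state minimal distance as one number -/

/-- Pairs of distinct particles of Lennard-Jones ground states (all particle numbers `N`), whose distances define `gsMinDist`. -/
def GSPair : Type :=
  {q : (Σ N : ℕ, (Fin N → EuclideanSpace ℝ (Fin 3)) × Fin N × Fin N) // IsGroundState lennardJones q.2.1 ∧ q.2.2.1 ≠ q.2.2.2}

/-- The distance of a ground-state pair. -/
def gsPairDist (q : GSPair) : ℝ := dist (q.1.2.1 q.1.2.2.1) (q.1.2.1 q.1.2.2.2)

/-- **`gsMinDist`** — the infimum of pair distances over ALL Lennard-Jones ground states (all `N`): positive by the TREE fact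
`LennardJonesMinimalDistance_holds` (`gsMinDist_pos`), at least `7/10` by the TREE theorem `lennardJones_groundState_dist_ge_seven_tenths`
(`seven_tenths_le_gsMinDist`), below every ground-state pair distance (`gsMinDist_le_dist`). -/
def gsMinDist : ℝ := ⨅ q : GSPair, gsPairDist q

/-- Ground-state pairs exist (TREE `LennardJonesGroundStatesExist_holds` at `N = 2`). -/
theorem gsPair_nonempty : Nonempty GSPair := by
  obtain ⟨z, hz⟩ := LennardJonesGroundStatesExist_holds 2
  have h01 : (0 : Fin 2) ≠ 1 := by decide
  exact ⟨⟨⟨2, z, (0 : Fin 2), (1 : Fin 2)⟩, hz, h01⟩⟩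

/-- `0 < gsMinDist` (TREE `LennardJonesMinimalDistance_holds`). -/
theorem gsMinDist_pos : 0 < gsMinDist := by
  obtain ⟨δ, hδ, hsep⟩ := LennardJonesMinimalDistance_holds
  haveI := gsPair_nonempty
  have : δ ≤ gsMinDist := le_ciInf fun q => hsep q.1.1 q.1.2.1 q.2.1 q.1.2.2.1 q.1.2.2.2 q.2.2
  linarith

/-- `gsMinDist` is below every pair distance of every ground state. -/
theorem gsMinDist_le_dist {N : ℕ} {y : Fin N → EuclideanSpace ℝ (Fin 3)} (hy : IsGroundState lennardJones y) {i j : Fin N}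
    (hij : i ≠ j) : gsMinDist ≤ dist (y i) (y j) := by
  have hbdd : BddBelow (Set.range gsPairDist) := ⟨0, by rintro _ ⟨q, rfl⟩; exact dist_nonneg⟩
  exact ciInf_le hbdd ⟨⟨N, y, i, j⟩, hy, hij⟩

/-- `7/10 ≤ gsMinDist` (TREE `lennardJones_groundState_dist_ge_seven_tenths`). -/
theorem seven_tenths_le_gsMinDist : (7 : ℝ) / 10 ≤ gsMinDist := by
  haveI := gsPair_nonempty
  exact le_ciInf fun q => lennardJones_groundState_dist_ge_seven_tenths q.2.1 q.2.2

/-- Every Lennard-Jones ground state is `gsMinDist`-separated (the separation hypothesis the doors below consume). -/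
theorem gs_separated {N : ℕ} {y : Fin N → EuclideanSpace ℝ (Fin 3)} (hy : IsGroundState lennardJones y) :
    ∀ i j : Fin N, i ≠ j → gsMinDist ≤ dist (y i) (y j) :=
  fun _ _ hij => gsMinDist_le_dist hy hij

/-! ## §2 Filling in cubed form (TREE `card_window_ge_of_not_voidAdj`) -/

/-- On a 2-void-free doubled window `B(c,2ρ)`, `ρ ≥ 2`, whose inner window holds a particle: `ρ³ ≤ 8·#B(c,ρ)`
(from the TREE floor `(ρ−1)³ ≤ #B(c,ρ)` and `ρ ≤ 2(ρ−1)`). -/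
theorem cube_le_eight_mul_card_of_voidFree {N : ℕ} {y : Fin N → EuclideanSpace ℝ (Fin 3)} {c : EuclideanSpace ℝ (Fin 3)} {ρ : ℝ}
    (hρ : 2 ≤ ρ) (hv : ∀ i : Fin N, dist (y i) c ≤ 2 * ρ → i ∉ voidAdjSet 2 y) (hne : ∃ i : Fin N, dist (y i) c ≤ ρ) :
    ρ ^ 3 ≤ 8 * ((Finset.univ.filter fun i : Fin N => dist (y i) c ≤ ρ).card : ℝ) := by
  have hfill : (ρ - 1) ^ 3 ≤ ((Finset.univ.filter fun i : Fin N => dist (y i) c ≤ ρ).card : ℝ) :=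
    card_window_ge_of_not_voidAdj y c (by linarith) (fun i hi => hv i hi) hne
  have h2 : ρ ≤ 2 * (ρ - 1) := by linarith
  have h3 : ρ ^ 3 ≤ (2 * (ρ - 1)) ^ 3 := pow_le_pow_left₀ (by linarith) h2 3
  nlinarith

/-! ## §3 The fraction-free core: radius rungs, «no loose chunks», the chunk door -/

/-- **`NoLooseChunkAt r`** — ONE RUNG IN THE RADIUS [GS-side · sieve-free · fraction-free · energy-free · `e⋆`-free]: NO Lennard-Jones ground
state (any `N`) has an all-`(3/50)`-loose, 2-void-free doubled window `B(c,2r)` whose inner window `B(c,r)` holds a particle. -/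
def NoLooseChunkAt (r : ℝ) : Prop :=
  ∀ (N : ℕ) (y : Fin N → EuclideanSpace ℝ (Fin 3)), IsGroundState lennardJones y →
    ∀ c : EuclideanSpace ℝ (Fin 3),
      (∀ i : Fin N, dist (y i) c ≤ 2 * r → i ∈ looseSet (3 / 50) y) →
        (∀ i : Fin N, dist (y i) c ≤ 2 * r → i ∉ voidAdjSet 2 y) → ∀ i : Fin N, r < dist (y i) c

/-- **NLC · `NoLooseChunks`** — «NO LOOSE CHUNKS» [sieve-free · energy-free · `e⋆`-free · fraction-free]: at all large radii `ρ`, a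
Lennard-Jones ground state has NO all-`(3/50)`-loose 2-void-free doubled window `B(c,2ρ)` whose inner window `B(c,ρ)` holds a particle —
equivalently, in 2-void-free ground-state matter the `(3/50)`-TIGHT particles are `2ρ₀`-dense.  [= NEAR ∧ exclusion for EVERY marker, §6] -/
def NoLooseChunks : Prop :=
  ∃ ρ₀ : ℝ, ∀ ρ : ℝ, ρ₀ ≤ ρ → ∀ (N : ℕ) (y : Fin N → EuclideanSpace ℝ (Fin 3)), IsGroundState lennardJones y →
    ∀ c : EuclideanSpace ℝ (Fin 3),
      (∀ i : Fin N, dist (y i) c ≤ 2 * ρ → i ∈ looseSet (3 / 50) y) →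
        (∀ i : Fin N, dist (y i) c ≤ 2 * ρ → i ∉ voidAdjSet 2 y) → ∀ i : Fin N, ρ < dist (y i) c

/-- **THE RECENTRING KERNEL**: the rung at radius `r ≥ 0` gives the rung at EVERY radius `ρ ≥ 2r` — recentre the doubled `r`-ball at the
offending particle (`B(y i, 2r) ⊆ B(c, 2ρ)` inherits all-loose and void-free, and its inner ball holds `y i` itself). -/
theorem noLooseChunkAt_of_le {r ρ : ℝ} (hr : 0 ≤ r) (hρ : 2 * r ≤ ρ) (h : NoLooseChunkAt r) : NoLooseChunkAt ρ := by
  intro N y hy c hl hv i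
  by_contra hin
  rw [not_lt] at hin
  have hsub : ∀ j : Fin N, dist (y j) (y i) ≤ 2 * r → dist (y j) c ≤ 2 * ρ := fun j hj =>
    calc dist (y j) c ≤ dist (y j) (y i) + dist (y i) c := dist_triangle _ _ _
      _ ≤ 2 * r + ρ := add_le_add hj hin
      _ ≤ 2 * ρ := by linarith
  have h0 := h N y hy (y i) (fun j hj => hl j (hsub j hj)) (fun j hj => hv j (hsub j hj)) i
  rw [dist_self] at h0
  linarith

/-- **NLC ⟺ ONE RUNG IN THE RADIUS**: «no loose chunks eventually» is «no loose chunk at SOME radius `r ≥ 0`». -/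
theorem noLooseChunks_iff_exists_at : NoLooseChunks ↔ ∃ r : ℝ, 0 ≤ r ∧ NoLooseChunkAt r := by
  constructor
  · rintro ⟨ρ₀, h⟩
    exact ⟨max ρ₀ 0, le_max_right _ _, fun N y hy c hl hv i => h _ (le_max_left _ _) N y hy c hl hv i⟩
  · rintro ⟨r, hr, h⟩
    exact ⟨2 * r, fun ρ hρ N y hy c hl hv i => noLooseChunkAt_of_le hr hρ h N y hy c hl hv i⟩

/-- One radius rung at `r ≥ 0` gives NLC. -/
theorem noLooseChunks_of_noLooseChunkAt {r : ℝ} (hr : 0 ≤ r) (h : NoLooseChunkAt r) : NoLooseChunks :=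
  noLooseChunks_iff_exists_at.mpr ⟨r, hr, h⟩

/-- NLC gives the radius rung at every large radius. -/
theorem noLooseChunkAt_of_noLooseChunks (h : NoLooseChunks) : ∃ ρ₀ : ℝ, ∀ ρ : ℝ, ρ₀ ≤ ρ → NoLooseChunkAt ρ := by
  obtain ⟨ρ₀, h⟩ := h
  exact ⟨ρ₀, fun ρ hρ N y hy c hl hv i => h ρ hρ N y hy c hl hv i⟩

/-- **`ChunkDoor r`** — THE FRACTION-FREE GS-FREE DOOR AT ONE RADIUS [GS-free · `e⋆`-free · `N`-free · sieve-free · fraction-free ·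
canonical (same `N`, `y' = y` off the doubled ball) · a compact `∀∃`-sentence per cardinality of the doubled ball]: every injective
`gsMinDist`-separated configuration whose doubled `r`-ball about `c` is all-`(3/50)`-loose and 2-void-free and whose inner `r`-ball HOLDS A
PARTICLE is STRICTLY IMPROVED by re-placing the particles of the doubled ball alone. -/
def ChunkDoor (r : ℝ) : Prop :=
  ∀ (N : ℕ) (y : Fin N → EuclideanSpace ℝ (Fin 3)), Function.Injective y →
    (∀ i j : Fin N, i ≠ j → gsMinDist ≤ dist (y i) (y j)) →
      ∀ c : EuclideanSpace ℝ (Fin 3),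
        (∀ i : Fin N, dist (y i) c ≤ 2 * r → i ∈ looseSet (3 / 50) y) →
          (∀ i : Fin N, dist (y i) c ≤ 2 * r → i ∉ voidAdjSet 2 y) →
            (∃ i : Fin N, dist (y i) c ≤ r) →
              ∃ y' : Fin N → EuclideanSpace ℝ (Fin 3), Function.Injective y' ∧ (∀ i : Fin N, 2 * r < dist (y i) c → y' i = y i) ∧
                interactionEnergy lennardJones y' < interactionEnergy lennardJones y

/-- **K6 · the door gives the rung**: a ground state admits no strict improvement (TREE `groundStateEnergy_lennardJones_le`). -/
theorem noLooseChunkAt_of_chunkDoor {r : ℝ} (h : ChunkDoor r) : NoLooseChunkAt r := by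
  intro N y hy c hl hv i
  by_contra hin
  rw [not_lt] at hin
  obtain ⟨y', hy'inj, -, hlt⟩ := h N y hy.1 (gs_separated hy) c hl hv ⟨i, hin⟩
  have hle : interactionEnergy lennardJones y ≤ interactionEnergy lennardJones y' := by
    rw [hy.2]
    exact groundStateEnergy_lennardJones_le hy'inj
  linarith

/-- ONE open chunk door at a radius `r ≥ 0` gives NLC. -/
theorem noLooseChunks_of_chunkDoor {r : ℝ} (hr : 0 ≤ r) (h : ChunkDoor r) : NoLooseChunks :=
  noLooseChunks_of_noLooseChunkAt hr (noLooseChunkAt_of_chunkDoor h)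

/-- **The door recentres too**: `ChunkDoor r → ChunkDoor r'` for `0 ≤ r`, `2r ≤ r'` (open the `r`-door about a particle of the inner `r'`-ball;
the particles it moves lie inside `B(c, 2r')`). -/
theorem chunkDoor_of_le {r r' : ℝ} (hr : 0 ≤ r) (hr' : 2 * r ≤ r') (h : ChunkDoor r) : ChunkDoor r' := by
  intro N y hinj hsep c hl hv hex
  obtain ⟨i, hi⟩ := hex
  have hsub : ∀ j : Fin N, dist (y j) (y i) ≤ 2 * r → dist (y j) c ≤ 2 * r' := fun j hj =>
    calc dist (y j) c ≤ dist (y j) (y i) + dist (y i) c := dist_triangle _ _ _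
      _ ≤ 2 * r + r' := add_le_add hj hi
      _ ≤ 2 * r' := by linarith
  have hii : dist (y i) (y i) ≤ r := by rw [dist_self]; exact hr
  obtain ⟨y', hy'inj, hy'eq, hlt⟩ :=
    h N y hinj hsep (y i) (fun j hj => hl j (hsub j hj)) (fun j hj => hv j (hsub j hj)) ⟨i, hii⟩
  refine ⟨y', hy'inj, fun j hj => hy'eq j ?_, hlt⟩
  have := dist_triangle (y j) (y i) c
  linarith

/-- The chunk door on EXPLICITLY separated configurations (pairwise distances `≥ 7/10`). -/
def ChunkDoorSep (r : ℝ) : Prop :=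
  ∀ (N : ℕ) (y : Fin N → EuclideanSpace ℝ (Fin 3)), Function.Injective y →
    (∀ i j : Fin N, i ≠ j → (7 : ℝ) / 10 ≤ dist (y i) (y j)) →
      ∀ c : EuclideanSpace ℝ (Fin 3),
        (∀ i : Fin N, dist (y i) c ≤ 2 * r → i ∈ looseSet (3 / 50) y) →
          (∀ i : Fin N, dist (y i) c ≤ 2 * r → i ∉ voidAdjSet 2 y) →
            (∃ i : Fin N, dist (y i) c ≤ r) →
              ∃ y' : Fin N → EuclideanSpace ℝ (Fin 3), Function.Injective y' ∧ (∀ i : Fin N, 2 * r < dist (y i) c → y' i = y i) ∧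
                interactionEnergy lennardJones y' < interactionEnergy lennardJones y

/-- The explicitly separated door opens the `gsMinDist` door (`7/10 ≤ gsMinDist`). -/
theorem chunkDoor_of_sep {r : ℝ} (h : ChunkDoorSep r) : ChunkDoor r :=
  fun N y hy hsep c hl hv hex => h N y hy (fun i j hij => seven_tenths_le_gsMinDist.trans (hsep i j hij)) c hl hv hex

/-! ## §4 The marker-generic fraction ladder -/

/-- A **marker**: a rule selecting, in every configuration of every particle number, a sub-finset of particle indices (the lineage's instance is
the sieve marker «`s`-far at sieve radius `ℓ`»; every order lemma below holds for an arbitrary marker). -/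
abbrev SiteMarker : Type := (N : ℕ) → (Fin N → EuclideanSpace ℝ (Fin 3)) → Finset (Fin N)

/-- **`NoMarkedChunkAt F ρ φ`** — ONE RUNG of the fraction ladder: at radius `ρ`, every all-`(3/50)`-loose, 2-void-free doubled window `B(c,2ρ)`
of a Lennard-Jones ground state has at most `φ·#B(c,ρ)` MARKED particles in `B(c,ρ)`.  [GS-side · energy-free · one scale] -/
def NoMarkedChunkAt (F : SiteMarker) (ρ φ : ℝ) : Prop :=
  ∀ (N : ℕ) (y : Fin N → EuclideanSpace ℝ (Fin 3)), IsGroundState lennardJones y →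
    ∀ c : EuclideanSpace ℝ (Fin 3),
      (∀ i : Fin N, dist (y i) c ≤ 2 * ρ → i ∈ looseSet (3 / 50) y) →
        (∀ i : Fin N, dist (y i) c ≤ 2 * ρ → i ∉ voidAdjSet 2 y) →
          ((Finset.univ.filter fun i : Fin N => dist (y i) c ≤ ρ ∧ i ∈ F N y).card : ℝ)
            ≤ φ * ((Finset.univ.filter fun i : Fin N => dist (y i) c ≤ ρ).card : ℝ)

/-- **`MarkedChunkExclusion F`** — for every fraction `φ > 0`, eventually in the radius, no marked-dense loose chunk. -/
def MarkedChunkExclusion (F : SiteMarker) : Prop :=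
  ∀ φ : ℝ, 0 < φ → ∃ ρe : ℝ, ∀ ρ : ℝ, ρe ≤ ρ → NoMarkedChunkAt F ρ φ

/-- The ONE-RADIUS form of exclusion: for every fraction `φ > 0` there is ONE radius `ρ ≥ 18` at which the rung holds
(equivalent to `MarkedChunkExclusion F`, `markedChunkExclusion_iff_oneRadius`, §5). -/
def MarkedChunkExclusionAtOneRadius (F : SiteMarker) : Prop :=
  ∀ φ : ℝ, 0 < φ → ∃ ρ : ℝ, 18 ≤ ρ ∧ NoMarkedChunkAt F ρ φ

/-- **`MarkedImplantDoor F ρ φ`** — THE GS-FREE DOOR OF THE FRACTION LADDER AT ONE RADIUS [GS-free · canonical (same `N`, `y' = y` off the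
doubled ball) · a compact `∀∃`-sentence per cardinality of the doubled ball]: every injective `gsMinDist`-separated configuration (any `N`; no
ground-state hypothesis) carrying an all-`(3/50)`-loose, 2-void-free doubled `ρ`-ball whose inner ball has marked fraction `> φ` is STRICTLY
IMPROVED by re-placing the particles of the doubled ball alone. -/
def MarkedImplantDoor (F : SiteMarker) (ρ φ : ℝ) : Prop :=
  ∀ (N : ℕ) (y : Fin N → EuclideanSpace ℝ (Fin 3)), Function.Injective y →
    (∀ i j : Fin N, i ≠ j → gsMinDist ≤ dist (y i) (y j)) →
      ∀ c : EuclideanSpace ℝ (Fin 3),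
        (∀ i : Fin N, dist (y i) c ≤ 2 * ρ → i ∈ looseSet (3 / 50) y) →
          (∀ i : Fin N, dist (y i) c ≤ 2 * ρ → i ∉ voidAdjSet 2 y) →
            φ * ((Finset.univ.filter fun i : Fin N => dist (y i) c ≤ ρ).card : ℝ)
                < ((Finset.univ.filter fun i : Fin N => dist (y i) c ≤ ρ ∧ i ∈ F N y).card : ℝ) →
              ∃ y' : Fin N → EuclideanSpace ℝ (Fin 3), Function.Injective y' ∧ (∀ i : Fin N, 2 * ρ < dist (y i) c → y' i = y i) ∧
                interactionEnergy lennardJones y' < interactionEnergy lennardJones y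

/-! ### Monotonicity -/

/-- Larger fraction = weaker rung. -/
theorem noMarkedChunkAt_mono_phi {F : SiteMarker} {ρ φ φ' : ℝ} (hφ : φ ≤ φ') (h : NoMarkedChunkAt F ρ φ) : NoMarkedChunkAt F ρ φ' := by
  intro N y hy c hl hv
  have hB : (0 : ℝ) ≤ ((Finset.univ.filter fun i : Fin N => dist (y i) c ≤ ρ).card : ℝ) := by positivity
  exact le_trans (h N y hy c hl hv) (mul_le_mul_of_nonneg_right hφ hB)

/-- Smaller marker = weaker rung. -/
theorem noMarkedChunkAt_anti_marker {F G : SiteMarker} (hFG : ∀ (N : ℕ) (y : Fin N → EuclideanSpace ℝ (Fin 3)), F N y ⊆ G N y)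
    {ρ φ : ℝ} (h : NoMarkedChunkAt G ρ φ) : NoMarkedChunkAt F ρ φ := by
  intro N y hy c hl hv
  refine le_trans ?_ (h N y hy c hl hv)
  exact_mod_cast Finset.card_le_card fun i hi => by
    simp only [Finset.mem_filter, Finset.mem_univ, true_and] at hi ⊢
    exact ⟨hi.1, hFG N y hi.2⟩

/-- The trivial rung: fraction `φ ≥ 1`. -/
theorem noMarkedChunkAt_of_one_le (F : SiteMarker) (ρ : ℝ) {φ : ℝ} (hφ : 1 ≤ φ) : NoMarkedChunkAt F ρ φ := by
  intro N y hy c hl hv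
  have hsub : ((Finset.univ.filter fun i : Fin N => dist (y i) c ≤ ρ ∧ i ∈ F N y).card : ℝ)
      ≤ ((Finset.univ.filter fun i : Fin N => dist (y i) c ≤ ρ).card : ℝ) := by
    exact_mod_cast Finset.card_le_card fun i hi => by
      simp only [Finset.mem_filter, Finset.mem_univ, true_and] at hi ⊢
      exact hi.1
  have hB : (0 : ℝ) ≤ ((Finset.univ.filter fun i : Fin N => dist (y i) c ≤ ρ).card : ℝ) := by positivity
  nlinarith

/-- Smaller marker = weaker exclusion. -/
theorem markedChunkExclusion_anti_marker {F G : SiteMarker} (hFG : ∀ (N : ℕ) (y : Fin N → EuclideanSpace ℝ (Fin 3)), F N y ⊆ G N y)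
    (h : MarkedChunkExclusion G) : MarkedChunkExclusion F := by
  intro φ hφ
  obtain ⟨ρe, hρe⟩ := h φ hφ
  exact ⟨ρe, fun ρ hρ => noMarkedChunkAt_anti_marker hFG (hρe ρ hρ)⟩

/-- Monotonicity of the door in the fraction. -/
theorem markedImplantDoor_mono_phi {F : SiteMarker} {ρ φ φ' : ℝ} (hφ : φ ≤ φ') (h : MarkedImplantDoor F ρ φ) :
    MarkedImplantDoor F ρ φ' := by
  intro N y hy hsep c hl hv hfrac
  have hB : (0 : ℝ) ≤ ((Finset.univ.filter fun i : Fin N => dist (y i) c ≤ ρ).card : ℝ) := by positivity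
  exact h N y hy hsep c hl hv (lt_of_le_of_lt (mul_le_mul_of_nonneg_right hφ hB) hfrac)

/-! ### K3: the door gives the rung; the chunk door is the `φ = 0` end of the family -/

/-- **K3 · `noMarkedChunkAt_of_implantDoor`**: a ground state admits no strict improvement, so the GS-free door gives the rung. -/
theorem noMarkedChunkAt_of_implantDoor {F : SiteMarker} {ρ φ : ℝ} (h : MarkedImplantDoor F ρ φ) : NoMarkedChunkAt F ρ φ := by
  intro N y hy c hl hv
  by_contra hnot
  rw [not_le] at hnot
  obtain ⟨y', hy'inj, -, hlt⟩ := h N y hy.1 (gs_separated hy) c hl hv hnot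
  have hle : interactionEnergy lennardJones y ≤ interactionEnergy lennardJones y' := by
    rw [hy.2]
    exact groundStateEnergy_lennardJones_le hy'inj
  linarith

/-- `ChunkDoor r ⟹ MarkedImplantDoor F r φ` for every marker and every `φ ≥ 0` (a positive marked count puts a particle in the inner ball). -/
theorem markedImplantDoor_of_chunkDoor (F : SiteMarker) {r φ : ℝ} (hφ : 0 ≤ φ) (h : ChunkDoor r) : MarkedImplantDoor F r φ := by
  intro N y hy hsep c hl hv hfrac
  refine h N y hy hsep c hl hv ?_
  by_contra hnone
  have hempty : (Finset.univ.filter fun i : Fin N => dist (y i) c ≤ r ∧ i ∈ F N y) = ∅ :=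
    Finset.filter_eq_empty_iff.mpr fun i _ hi => hnone ⟨i, hi.1⟩
  rw [hempty, Finset.card_empty, Nat.cast_zero] at hfrac
  have h0 : 0 ≤ φ * ((Finset.univ.filter fun i : Fin N => dist (y i) c ≤ r).card : ℝ) := by positivity
  linarith

/-! ### The fraction-0 rung is the radius rung with the marker erased -/

/-- The radius rung is the fraction-ZERO rung with the marker erased: `NoLooseChunkAt r ⟹ NoMarkedChunkAt F r 0` for every marker. -/
theorem noMarkedChunkAt_zero_of_noLooseChunkAt (F : SiteMarker) {r : ℝ} (h : NoLooseChunkAt r) : NoMarkedChunkAt F r 0 := by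
  intro N y hy c hl hv
  have hempty : (Finset.univ.filter fun i : Fin N => dist (y i) c ≤ r ∧ i ∈ F N y) = ∅ :=
    Finset.filter_eq_empty_iff.mpr fun i _ hi => absurd hi.1 (not_le.mpr (h N y hy c hl hv i))
  rw [hempty, Finset.card_empty, Nat.cast_zero, zero_mul]

/-- NLC ⟹ every rung at every large radius, at fraction ZERO, for every marker. -/
theorem noMarkedChunkAt_zero_of_noLooseChunks (h : NoLooseChunks) (F : SiteMarker) :
    ∃ ρ₀ : ℝ, ∀ ρ : ℝ, ρ₀ ≤ ρ → NoMarkedChunkAt F ρ 0 := by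
  obtain ⟨ρ₀, h0⟩ := noLooseChunkAt_of_noLooseChunks h
  exact ⟨ρ₀, fun ρ hρ => noMarkedChunkAt_zero_of_noLooseChunkAt F (h0 ρ hρ)⟩

/-- **NLC ⟹ exclusion** for every marker (vacuously: no window, no marked chunk). -/
theorem markedChunkExclusion_of_noLooseChunks (h : NoLooseChunks) (F : SiteMarker) : MarkedChunkExclusion F := by
  intro φ hφ
  obtain ⟨ρ₀, h0⟩ := noMarkedChunkAt_zero_of_noLooseChunks h F
  exact ⟨ρ₀, fun ρ hρ => noMarkedChunkAt_mono_phi hφ.le (h0 ρ hρ)⟩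

/-- **Fraction-0 recentring** (no transfer loss at `φ = 0`): the fraction-0 rung at radius `ρ ≥ 0` gives it at every `ρ' ≥ 2ρ`. -/
theorem noMarkedChunkAt_zero_of_le {F : SiteMarker} {ρ ρ' : ℝ} (hρ : 0 ≤ ρ) (h2 : 2 * ρ ≤ ρ') (h : NoMarkedChunkAt F ρ 0) :
    NoMarkedChunkAt F ρ' 0 := by
  intro N y hy c hl hv
  rw [zero_mul]
  have hempty : (Finset.univ.filter fun i : Fin N => dist (y i) c ≤ ρ' ∧ i ∈ F N y) = ∅ := by
    refine Finset.filter_eq_empty_iff.mpr fun i _ hi => ?_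
    have hsub : ∀ j : Fin N, dist (y j) (y i) ≤ 2 * ρ → dist (y j) c ≤ 2 * ρ' := fun j hj =>
      calc dist (y j) c ≤ dist (y j) (y i) + dist (y i) c := dist_triangle _ _ _
        _ ≤ 2 * ρ + ρ' := add_le_add hj hi.1
        _ ≤ 2 * ρ' := by linarith
    have h0 := h N y hy (y i) (fun j hj => hl j (hsub j hj)) (fun j hj => hv j (hsub j hj))
    rw [zero_mul] at h0
    have hii : dist (y i) (y i) ≤ ρ := by rw [dist_self]; exact hρ
    have hmem : i ∈ (Finset.univ.filter fun j : Fin N => dist (y j) (y i) ≤ ρ ∧ j ∈ F N y) :=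
      Finset.mem_filter.mpr ⟨Finset.mem_univ _, hii, hi.2⟩
    have hpos : (0 : ℝ) < ((Finset.univ.filter fun j : Fin N => dist (y j) (y i) ≤ ρ ∧ j ∈ F N y).card : ℝ) := by
      exact_mod_cast Finset.card_pos.mpr ⟨i, hmem⟩
    linarith
  rw [hempty, Finset.card_empty, Nat.cast_zero]

/-- The fraction-ZERO rung at ONE radius `ρ ≥ 0` is already exclusion for that marker. -/
theorem markedChunkExclusion_of_rung_zero {F : SiteMarker} {ρ : ℝ} (hρ : 0 ≤ ρ) (h : NoMarkedChunkAt F ρ 0) : MarkedChunkExclusion F :=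
  fun _ hφ => ⟨2 * ρ, fun _ hρ' => noMarkedChunkAt_mono_phi hφ.le (noMarkedChunkAt_zero_of_le hρ hρ' h)⟩

end Summit.AtomisticToContinuum.Crystallization.Theorems.ContactSaturationLadderChunkDoor

end
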